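import Mathlib
import Summits.ValiantsHypothesis.ValiantsHypothesis.Theorems.LiouvilleSarnakAlignedCutRank

/-!
# Route LiouvilleSarnak — crux `LiouvilleCutRank` (stmt-ValiantsHypothesis-14775):
# scattered blocks with the GAP-ONES filler — the telescoped form and the two structural identities

After `…ScatteredBlocks` / `…Filler` / `…Select` (crux ⟸ filled scattered-block hypothesis) and `…ScatteredBlocksBarrier`
(the ZERO filler is hopeless: rank `1` for the completely multiplicative twin `(-1)^{v₂} χ₄`), the object to study is the
scattered-block matrix with the GAP-ONES filler `H = Σ_{i<t} (2^{g(i+1)} - 2^{g i + 2})` (binary ones strictly between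
consecutive blocks), for which the automatic twins have rank growing like the number of blocks (numerics of this hand).
This file records its arithmetic, for ARBITRARY gap sequences, as the starting point of that study:

* §1 `filled_telescope` — `1 + H + Σ_i d_i 2^{g i} = (d_t + 1) 2^{g t} - Σ_{i<t} (3 - d_i) 2^{g i}` (in `ℤ`): the filled
  matrix is `λ` at sparse perturbations BELOW the four points `2^{g t}, 2·2^{g t}, 3·2^{g t}, 4·2^{g t}` with "negative
  digits" `3 - d_i ∈ {0,1,2,3}`.
* §2 `filled_carry` — (F) CARRY: with bottom digit `d_0 = 3` the filled number is `2^{g 1}` times the filled number of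
  the tail configuration `(g i - g 1)_{i≥1}` (same digits): the class `x_0 = y_0 = 1` reproduces the next level EXACTLY,
  for every first gap (the zero filler has this only for `g 1 = 2`); `filled_three` — (T₃) inside ONE column: the entry
  at row `(0, w, 1)`, column `(0, w, 0)` is `3 ×` the entry at row `(1, 1, …, 1, 0)`, same column
  (`3·2^{g t} - 3 - Σ 3(1 - w_i) 2^{g i} = 3 (2^{g t} - 1 - Σ (1 - w_i) 2^{g i})`).
* §3 `liouville_filled_carry`, `liouville_filled_three` — the same for `λ` (`λ(2^a m) = (-1)^a λ(m)`, `λ(3m) = -λ(m)`).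

These are exactly the two inputs of `…InterleavedUnbounded` transported to arbitrary gaps; the census of this hand
(evidence on stmt-14775) explains why they alone do not yet give growth (the counting argument needs (T₃) for every row of
the carry class, available only through `RR`-free stretches) and what is conjectured (filled rank `≥` number of blocks for
every completely multiplicative `f` with `f(2) = -1`).  Honest framing: identities, no rank statement; `LiouvilleCutRank`,
`DigitalBilinearLiouville`, `AlgebraicSarnak` stay OPEN; nothing bears on `VP ≠ VNP`.  No definitions.
-/

set_option linter.dupNamespace false

noncomputable section

namespace Summit.ValiantsHypothesis.ValiantsHypothesis.Theorems.LiouvilleSarnakLiouvilleCutRank.ScatteredBlocksFilledIdentities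

open ArithmeticFunction Finset

open Summit.ValiantsHypothesis.ValiantsHypothesis.Theorems.LiouvilleSarnakAligned (liouville_two_pow_mul)

/-! ### §1 The telescoped form of the filled number -/

/-- **Telescoping.**  For a normalised block configuration `0 = g 0`, `g i + 2 ≤ g j` (`i < j`), digits `d i ≤ 3`, and the
GAP-ONES filler `H = Σ_{i<t} (2^{g(i+1)} - 2^{g i + 2})` (binary ones strictly between consecutive blocks), the filled number
is `1 + H + Σ_i d_i 2^{g i} = (d_t + 1) 2^{g t} - Σ_{i<t} (3 - d_i) 2^{g i}` (stated in `ℤ`). [this file] -/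
theorem filled_telescope (t : ℕ) (g : Fin (t + 1) → ℕ) (hg0 : g 0 = 0)
    (hg : ∀ i j : Fin (t + 1), i < j → g i + 2 ≤ g j) (d : Fin (t + 1) → ℕ) :
    (((1 + ∑ i : Fin t, (2 ^ (g i.succ) - 2 ^ (g (Fin.castSucc i) + 2))) +
        (∑ i : Fin (t + 1), d i * 2 ^ (g i)) : ℕ) : ℤ) =
      ((d (Fin.last t) : ℤ) + 1) * 2 ^ (g (Fin.last t)) -
        ∑ i : Fin t, (3 - (d (Fin.castSucc i) : ℤ)) * 2 ^ (g (Fin.castSucc i)) := by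
  have hle : ∀ i : Fin t, 2 ^ (g (Fin.castSucc i) + 2) ≤ 2 ^ (g i.succ) := fun i =>
    Nat.pow_le_pow_right (by norm_num) (hg _ _ Fin.castSucc_lt_succ)
  push_cast [Nat.cast_sub (hle _)]
  -- the two shifted sums of `2^{g i}`
  have h1 : ∑ i : Fin (t + 1), (2 : ℤ) ^ (g i) = 2 ^ (g 0) + ∑ i : Fin t, (2 : ℤ) ^ (g i.succ) :=
    Fin.sum_univ_succ _
  have h2 : ∑ i : Fin (t + 1), (2 : ℤ) ^ (g i) = (∑ i : Fin t, (2 : ℤ) ^ (g (Fin.castSucc i))) + 2 ^ (g (Fin.last t)) :=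
    Fin.sum_univ_castSucc _
  have h3 : ∑ i : Fin (t + 1), (d i : ℤ) * 2 ^ (g i) =
      (∑ i : Fin t, (d (Fin.castSucc i) : ℤ) * 2 ^ (g (Fin.castSucc i))) + (d (Fin.last t) : ℤ) * 2 ^ (g (Fin.last t)) :=
    Fin.sum_univ_castSucc _
  have h4 : ∑ i : Fin t, ((2 : ℤ) ^ (g i.succ) - 2 ^ (g (Fin.castSucc i) + 2)) =
      (∑ i : Fin t, (2 : ℤ) ^ (g i.succ)) - 4 * ∑ i : Fin t, (2 : ℤ) ^ (g (Fin.castSucc i)) := by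
    rw [Finset.sum_sub_distrib, Finset.mul_sum]
    congr 1
    refine Finset.sum_congr rfl (fun i _ => ?_)
    rw [pow_add]; ring
  have h5 : ∑ i : Fin t, (3 - (d (Fin.castSucc i) : ℤ)) * 2 ^ (g (Fin.castSucc i)) =
      3 * (∑ i : Fin t, (2 : ℤ) ^ (g (Fin.castSucc i))) -
        ∑ i : Fin t, (d (Fin.castSucc i) : ℤ) * 2 ^ (g (Fin.castSucc i)) := by
    rw [Finset.mul_sum, ← Finset.sum_sub_distrib]
    refine Finset.sum_congr rfl (fun i _ => ?_)
    ring
  rw [hg0, pow_zero] at h1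
  rw [h4, h3, h5]
  linear_combination h2 - h1

/-! ### §2 The carry identity (F) and the factor-three identity (T₃) of the filled matrix -/

/-- **(F) Carry through the first gap.**  With `d_0 = 3` the filled number is `2^{g 1}` times the filled number of the TAIL
configuration `(g i - g 1)_{i ≥ 1}` with the same digits: both sides telescope to `(d_t + 1) 2^{g t} - Σ_{1 ≤ i < t} (3 - d_i) 2^{g i}`.
Stated for `t + 2` blocks (`g : Fin (t+2) → ℕ`, tail `Fin (t+1)`). [this file] -/
theorem filled_carry (t : ℕ) (g : Fin (t + 2) → ℕ) (hg0 : g 0 = 0)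
    (hg : ∀ i j : Fin (t + 2), i < j → g i + 2 ≤ g j) (d : Fin (t + 2) → ℕ) (hd0 : d 0 = 3) :
    (((1 + ∑ i : Fin (t + 1), (2 ^ (g i.succ) - 2 ^ (g (Fin.castSucc i) + 2))) +
        (∑ i : Fin (t + 2), d i * 2 ^ (g i)) : ℕ) : ℤ) =
      2 ^ (g 1) * (((1 + ∑ i : Fin t, (2 ^ (g i.succ.succ - g 1) - 2 ^ ((g (Fin.castSucc i).succ - g 1) + 2))) +
        (∑ i : Fin (t + 1), d i.succ * 2 ^ (g i.succ - g 1)) : ℕ) : ℤ) := by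
  have hmono : ∀ i : Fin (t + 1), g 1 ≤ g i.succ := by
    intro i
    rcases eq_or_lt_of_le (show (1 : Fin (t + 2)) ≤ i.succ from by
      rw [Fin.le_def]; simp) with h | h
    · rw [← h]
    · have := hg 1 i.succ h; omega
  have hT := filled_telescope t (fun i => g i.succ - g 1) (by simp) (by
      intro i j hij
      have := hg i.succ j.succ (Fin.succ_lt_succ_iff.mpr hij)
      have := hmono i; have := hmono j
      show g i.succ - g 1 + 2 ≤ g j.succ - g 1
      omega) (fun i => d i.succ)
  simp only [Fin.succ_last] at hT
  rw [filled_telescope (t + 1) g hg0 hg d, hT, Fin.sum_univ_succ]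
  simp only [Fin.castSucc_zero, hd0, Nat.cast_ofNat, sub_self, zero_mul, zero_add]
  have hpow : ∀ i : Fin (t + 1), (2 : ℤ) ^ (g 1) * 2 ^ (g i.succ - g 1) = 2 ^ (g i.succ) := by
    intro i; rw [← pow_add]; congr 1; have := hmono i; omega
  have hpowL : (2 : ℤ) ^ (g 1) * 2 ^ (g (Fin.last (t + 1)) - g 1) = 2 ^ (g (Fin.last (t + 1))) := by
    have h := hpow (Fin.last t)
    rwa [Fin.succ_last] at h
  simp only [Nat.succ_eq_add_one] at hT ⊢
  rw [mul_sub, Finset.mul_sum]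
  congr 1
  · rw [mul_left_comm, hpowL]
  · refine Finset.sum_congr rfl (fun i _ => ?_)
    rw [← Fin.succ_castSucc, mul_left_comm, hpow (Fin.castSucc i)]

/-- **(T₃) A factor three inside one column.**  For `t + 2` blocks: the filled number with digits `d = (0, 3w, 2)`
(`d_0 = 0`, middle digits `d_i = 3 w_i ∈ {0, 3}`, top `d = 2`) is THREE times the filled number with digits
`d' = (2, 2 + w, 0)` — in row/column terms (`d_i = 2 x_i + y_i`): the entry at row `x = (0, w, 1)`, column
`y = (0, w, 0)` versus the entry at row `x' = (1, 1, …, 1, 0)`, SAME column.  (Middle condition: `3 d'_i = d_i + 6`.)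
[this file] -/
theorem filled_three (t : ℕ) (g : Fin (t + 2) → ℕ) (hg0 : g 0 = 0)
    (hg : ∀ i j : Fin (t + 2), i < j → g i + 2 ≤ g j) (d d' : Fin (t + 2) → ℕ)
    (hd0 : d 0 = 0) (hd0' : d' 0 = 2) (hdL : d (Fin.last (t + 1)) = 2) (hdL' : d' (Fin.last (t + 1)) = 0)
    (hmid : ∀ i : Fin (t + 2), i ≠ 0 → i ≠ Fin.last (t + 1) → 3 * d' i = d i + 6) :
    (1 + ∑ i : Fin (t + 1), (2 ^ (g i.succ) - 2 ^ (g (Fin.castSucc i) + 2))) + ∑ i : Fin (t + 2), d i * 2 ^ (g i) =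
      3 * ((1 + ∑ i : Fin (t + 1), (2 ^ (g i.succ) - 2 ^ (g (Fin.castSucc i) + 2))) +
        ∑ i : Fin (t + 2), d' i * 2 ^ (g i)) := by
  have h1 := filled_telescope (t + 1) g hg0 hg d
  have h2 := filled_telescope (t + 1) g hg0 hg d'
  have hs : ∀ e : Fin (t + 2) → ℕ, ∑ i : Fin (t + 1), (3 - (e (Fin.castSucc i) : ℤ)) * 2 ^ (g (Fin.castSucc i)) =
      (3 - (e 0 : ℤ)) * 2 ^ (g 0) + ∑ j : Fin t, (3 - (e (Fin.castSucc j.succ) : ℤ)) * 2 ^ (g (Fin.castSucc j.succ)) := by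
    intro e
    rw [Fin.sum_univ_succ, Fin.castSucc_zero]
  have hsum : ∑ i : Fin t, (3 - (d (Fin.castSucc i.succ) : ℤ)) * 2 ^ (g (Fin.castSucc i.succ)) =
      3 * ∑ i : Fin t, (3 - (d' (Fin.castSucc i.succ) : ℤ)) * 2 ^ (g (Fin.castSucc i.succ)) := by
    rw [Finset.mul_sum]
    refine Finset.sum_congr rfl (fun i _ => ?_)
    have hne0 : Fin.castSucc i.succ ≠ (0 : Fin (t + 2)) := by
      rw [← Fin.succ_castSucc]; exact Fin.succ_ne_zero _
    have hneL : Fin.castSucc i.succ ≠ Fin.last (t + 1) := (Fin.castSucc_lt_last _).ne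
    have h := hmid _ hne0 hneL
    have h' : ((3 : ℤ) - (d (Fin.castSucc i.succ) : ℤ)) = 3 * (3 - (d' (Fin.castSucc i.succ) : ℤ)) := by
      have : (3 : ℤ) * (d' (Fin.castSucc i.succ) : ℤ) = (d (Fin.castSucc i.succ) : ℤ) + 6 := by exact_mod_cast h
      linarith
    rw [h']; ring
  have key : (((1 + ∑ i : Fin (t + 1), (2 ^ (g i.succ) - 2 ^ (g (Fin.castSucc i) + 2))) +
      ∑ i : Fin (t + 2), d i * 2 ^ (g i) : ℕ) : ℤ) =
      3 * (((1 + ∑ i : Fin (t + 1), (2 ^ (g i.succ) - 2 ^ (g (Fin.castSucc i) + 2))) +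
        ∑ i : Fin (t + 2), d' i * 2 ^ (g i) : ℕ) : ℤ) := by
    rw [h1, h2, hs d, hs d', hsum, hd0, hd0', hdL, hdL', hg0]
    push_cast
    ring
  exact_mod_cast key

/-! ### §3 The two identities for the Liouville function -/

/-- `λ(3m) = -λ(m)`. [folklore] -/
theorem liouville_three_mul (m : ℕ) : liouville (3 * m) = -liouville m := by
  rw [liouville_apply_mul, liouville_apply three_ne_zero, cardFactors_apply_prime Nat.prime_three, pow_one]
  ring

/-- ★ **(F) for `λ`.**  In the gap-ones-filled scattered-block matrix, the entries with bottom digit `3` (`x_0 = y_0 = 1`)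
are `(-1)^{g 1}` times the entries of the filled matrix of the TAIL configuration `(g i - g 1)_{i ≥ 1}`: the carry class
reproduces the next level exactly (self-similarity for ARBITRARY gaps, which the zero filler has only for `g 1 = 2`).
[this file] -/
theorem liouville_filled_carry (t : ℕ) (g : Fin (t + 2) → ℕ) (hg0 : g 0 = 0)
    (hg : ∀ i j : Fin (t + 2), i < j → g i + 2 ≤ g j) (d : Fin (t + 2) → ℕ) (hd0 : d 0 = 3) :
    liouville ((1 + ∑ i : Fin (t + 1), (2 ^ (g i.succ) - 2 ^ (g (Fin.castSucc i) + 2))) +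
        ∑ i : Fin (t + 2), d i * 2 ^ (g i)) =
      (-1) ^ (g 1) * liouville ((1 + ∑ i : Fin t, (2 ^ (g i.succ.succ - g 1) - 2 ^ ((g (Fin.castSucc i).succ - g 1) + 2))) +
        ∑ i : Fin (t + 1), d i.succ * 2 ^ (g i.succ - g 1)) := by
  have h := filled_carry t g hg0 hg d hd0
  have h' : (1 + ∑ i : Fin (t + 1), (2 ^ (g i.succ) - 2 ^ (g (Fin.castSucc i) + 2))) +
        ∑ i : Fin (t + 2), d i * 2 ^ (g i) =
      2 ^ (g 1) * ((1 + ∑ i : Fin t, (2 ^ (g i.succ.succ - g 1) - 2 ^ ((g (Fin.castSucc i).succ - g 1) + 2))) +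
        ∑ i : Fin (t + 1), d i.succ * 2 ^ (g i.succ - g 1)) := by exact_mod_cast h
  rw [h', liouville_two_pow_mul]

/-- ★ **(T₃) for `λ`.**  Under the hypotheses of `filled_three` the two filled entries have opposite Liouville sign:
`λ(entry at row (0, w, 1), column (0, w, 0)) = -λ(entry at row (1, …, 1, 0), same column)`. [this file] -/
theorem liouville_filled_three (t : ℕ) (g : Fin (t + 2) → ℕ) (hg0 : g 0 = 0)
    (hg : ∀ i j : Fin (t + 2), i < j → g i + 2 ≤ g j) (d d' : Fin (t + 2) → ℕ)
    (hd0 : d 0 = 0) (hd0' : d' 0 = 2) (hdL : d (Fin.last (t + 1)) = 2) (hdL' : d' (Fin.last (t + 1)) = 0)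
    (hmid : ∀ i : Fin (t + 2), i ≠ 0 → i ≠ Fin.last (t + 1) → 3 * d' i = d i + 6) :
    liouville ((1 + ∑ i : Fin (t + 1), (2 ^ (g i.succ) - 2 ^ (g (Fin.castSucc i) + 2))) +
        ∑ i : Fin (t + 2), d i * 2 ^ (g i)) =
      -liouville ((1 + ∑ i : Fin (t + 1), (2 ^ (g i.succ) - 2 ^ (g (Fin.castSucc i) + 2))) +
        ∑ i : Fin (t + 2), d' i * 2 ^ (g i)) := by
  rw [filled_three t g hg0 hg d d' hd0 hd0' hdL hdL' hmid, liouville_three_mul]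

end Summit.ValiantsHypothesis.ValiantsHypothesis.Theorems.LiouvilleSarnakLiouvilleCutRank.ScatteredBlocksFilledIdentities

end
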